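import Summits.CriticalPhenomena.PercolationContinuityZ3.Theorems.Transplant.SkelPhiFaceDataNV
import Summits.CriticalPhenomena.PercolationContinuityZ3.Theorems.Transplant.SkelPhiFaceDataN
import Summits.CriticalPhenomena.PercolationContinuityZ3.Theorems.Transplant.PlanarCells2BoundsV
import Summits.CriticalPhenomena.PercolationContinuityZ3.Theorems.Transplant.SkelPhiFaceDataNHist
import Literature.Probability.Percolation.OrientedHistorySiteRenormalizationRun
import Summits.CriticalPhenomena.PercolationContinuityZ3.Theorems.Transplant.SkelPhiCellsWeakGV
import Summits.CriticalPhenomena.PercolationContinuityZ3.Theorems.Transplant.SkelPhiFaceStepNV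
import Summits.CriticalPhenomena.PercolationContinuityZ3.Theorems.Transplant.KNCells2SchemeO
import Summits.CriticalPhenomena.PercolationContinuityZ3.Theorems.Transplant.KNCellsSchemeO
import Summits.CriticalPhenomena.PercolationContinuityZ3.Theorems.Transplant.PlanarCells2VArm
import Summits.CriticalPhenomena.PercolationContinuityZ3.Theorems.Transplant.PlanarCells2VDefs
import HarnessLib
import Summits.CriticalPhenomena.PercolationContinuityZ3.Theorems.Transplant.SkelPhiFaceDataNbV
import Summits.CriticalPhenomena.PercolationContinuityZ3.Theorems.Transplant.SkelPhiFaceDataNb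
import Summits.CriticalPhenomena.PercolationContinuityZ3.Theorems.Transplant.SkelPhiFaceStepNbV
import Summits.CriticalPhenomena.PercolationContinuityZ3.Theorems.Transplant.SkelPhiFaceStepNb
import Summits.CriticalPhenomena.PercolationContinuityZ3.Theorems.Transplant.SkelPhiFaceDataNbHist
import Summits.CriticalPhenomena.PercolationContinuityZ3.Theorems.Transplant.SkelPhiCellsSmallMV
/-!
J23/(R-45) SUCCESSOR `…V` (hp-8 g42, 2026-08-23; ruling lead g12 11:31:15Z, design owner p3-g17 (R-44)/(R-45)): the twin of `SkelPhiFaceDataNHistT` over the cell structure with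
per-axis ASYMMETRIC transverse rooms `PCells2V` (PlanarCells2VDefs: the slab family `Stub/Zone/Face/Hfull/faceLo/faceHi` has transverse interval `σ·[−hB∥, hF∥]`,
`hB, hF ≤ 2r⊥`, instead of `[−2r⊥, 2r⊥]`; every other box verbatim); statements and proofs VERBATIM with `PCells2T ↦ PCells2V` (+ the renames of record of the
V layer below it); the only mathematical touch points are the places that read the symmetric transverse room (listed in the lane line of this file's landing).
NO landed file is edited; `SkelPhiFaceDataNHistT` stays valid (it is the instance `PCells2T.toV`, `hB = hF = 2r⊥`). NON-VACUITY: inherited verbatim from `SkelPhiFaceDataNHistT` (same witness line).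

(R-40) SUCCESSOR `…T` (hp-8 g42, 2026-08-23; ruling p3-g16 06:23:56Z, J18): the twin of `SkelPhiFaceDataNHistS` over the PER-AXIS creep cap `PCells2V` (PlanarCells2TDefs:
`c i ≤ r (oth i)` instead of the uniform `c i ≤ cmax ≤ r j`); statements and proofs VERBATIM with `PCells2S ↦ PCells2V` (+ the renames of record of the T layer below it);
the only mathematical touch points are the places that read the cap, which only ever need the cross form `c (oth j) ≤ r j` (listed in the lane line of this file's landing).
NO landed file is edited; `SkelPhiFaceDataNHistS` stays valid (and is an instance of this file through `PCells2S.toT`). NON-VACUITY: inherited verbatim from `SkelPhiFaceDataNHistS` (same witness line).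

# N2 (frames-only node `SamePDropOfSkeletonFrm₁`, OPEN) — WAVE 1, (F) face-data column over STAGGERED cells ((R-22) `PCells2V`, (R-28)(β) one landing per file): the twin of N1's `SkelPhiFaceDataNHist`

builds on p205010 (kernel theorem, internal audit signed; external expert review pending) — nothing in this file uses p205010; NOTHING is claimed about the
open node `SamePDropOfSkeletonFrm₁` (`SamePDropOfSkeletonNeg₁` is CLOSED in the tree and untouched by this file).
Status sentence (coordinator 2026-08-20T04:30Z): "θ(p_c) = 0 on ℤ^d, all d ≥ 2 — kernel-verified (Lean 4/Mathlib, standard axioms); internal adversarial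
audit SIGNED 2026-08-20 04:29Z; external expert review pending."
Lane `prim-bschramm`, seat `prim-hp-8` (gen 40); helper file (`--supports stmt-CriticalPhenomena-4575 --as helper`); design owner p3-g15 ((R-22) staggered
cells `PCells2V`, (R-27)/(R-29) far regions of record `FarNS/FarNS₂`, (R-28)(β), naming 2026-08-22T23:00:04Z: suffix `S`).
PORT RULES (HOME/prim-hp-8/code/gen40/orient/bin/port_s.py = stmt-g19's port_orient.py + the G token table): the cells are `P : PCells2V`, every box is
read about the STAGGERED centre `cenS` (`PlanarCells2SDefs/SFar/ContainS/SArm/SepS/SepInfS/LevelsS/EfarN2S`), the scheme record is `cellGeomSG₂V`/`cellGeomSG₂bV`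
(`SkelPhiCellsWeakGS/…SmallMS`: narrow arm `BtwNS`, two-block far region `FarNS₂`), the history-site API is the ORIENTED one at `qNE` where it occurs
(`ochoice qNE`, `onwardO`, `Valid₂O`, `IsRun₂O`, …, (R-18)); EVERY declaration is re-declared with the suffix `S` (same namespace). Docstrings/citations are N1's.
N1 HEADER (kept for the reader):
* `isSubbox_faceStepWN (hlipψ) (hws)`, `faceStepWN_Rg_subset_Sfin`, `root_mem_faceStepWN_Sfin`, `faceStepWN_root_eq`, `root_not_mem_faceStepWN_Rg`,
  `finSupp_faceStepWN`, **`hdiam_fine`** (planar diameter `m` of `E^far` under `φ`: rooms `(rdK 1 b' + rdK 0 b')(50 rmax + 1)D ≤ Mabs(m+1)`),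
  **`rim_excess_faceStepWN (hlipψ) (hws)`** (excess radius for a planar map `φ'` at planar diameter `m` of `E^far`).
[cite: KozmaNitzan2024, §4 p. 27 ((30)), p. 28 (Ω), p. 31, Lemma 12 (p. 24)] [cite: MartineauSevero2019, Cor. 2.2]
-/
noncomputable section

open MeasureTheory
open scoped Classical

namespace Summit.CriticalPhenomena.PercolationContinuityZ3.Theorems.Transplant

namespace Skelφ

open Literature.Probability.Percolation Literature.Probability.LatticeModels SimpleGraph KNCells KNLevels GadgetSystem Contour
open Literature.Probability.Percolation.KozmaNitzan
open Literature.Probability.Percolation.KozmaNitzan.Cells (oth oth_ne sgOf sgOf_sign stepVec_apply_fst stepVec_apply_oth eq_oth_of_ne oth_oth)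
open Literature.Barriers.CriticalPhenomena (graphBall graphBall_finite mem_graphBall_self graphBall_mono)
open BoxProdZ2 (ConcRadiiG mem_graphBall_succ_of_adj)
open Skel (winGraph WinStepData excess)

variable {V : Type} [DecidableEq V] {G : SimpleGraph V} [G.LocallyFinite]
variable {pr : FinePrm} {φ : V → Site 2} {P : PCells2V} {w₀ : V} {Λ : ConcRadiiG} {b : Fin 2}

/-! ## §3 The clauses that need the history: subbox, support, root, planar diameter, rim excess -/

section History

variable {S : KSchA V ℕ} (hΓ : S.Γ = cellGeomSG₂V G (pr.ψ φ w₀) P w₀ Λ) (hΛ : WFS2 P.toPCells2 Λ)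
variable {h : ProbeHistory V} {e : Site 2 × MDir} (hV : S.Valid₂O G h e) {a a' : ℕ} {du : MDir} (hdu : du ∈ S.onwardO G h (tgt e))
variable {j : ℕ} {o : Finset (Sym2 V)} (pc : ℤ) (aw Rlev N M L' : ℕ)

include hΓ hΛ hV hdu

/-- **The region of the face step is a subbox of `Wt` in its window graph** (from `Lip`, weak steps of the cell map). [cite: KozmaNitzan2024, §4 p. 31] -/
theorem isSubbox_faceStepWNV (hlipψ : Lip G (pr.ψ φ w₀)) (hws : WeakSteps G (pr.ψ φ w₀)) (hjK : j + 1 ≤ P.K) :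
    let Q := faceStepWNV G pr φ P w₀ Λ b a' (tgt e) du j pc aw Rlev N M L' (S.Sx G h e a a' du)
    KNLevels.IsSubbox (winGraph G Q.root Q.Rπ) (S.Wt G h e a a' du j o) S.p (stepRg G (pr.frame φ w₀ du.1 b) Q) :=
  isSubbox_Wt_sub₂V hΓ hΛ hV hdu hlipψ hws hjK (stepRgN_subset_WinV G pr φ P w₀ Λ b a' (tgt e) du j pc aw Rlev N M L' _)

omit hV hdu in
/-- `Rg ⊆ Sfin = Sx` (from `Lip`, weak steps). [folklore] -/
theorem faceStepWN_Rg_subset_SfinV (hlipψ : Lip G (pr.ψ φ w₀)) (hws : WeakSteps G (pr.ψ φ w₀)) :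
    let Q := faceStepWNV G pr φ P w₀ Λ b a' (tgt e) du j pc aw Rlev N M L' (S.Sx G h e a a' du)
    stepRg G (pr.frame φ w₀ du.1 b) Q ⊆ Q.Sfin :=
  sub_subset_Sx₂V hΓ hΛ hlipψ hws (stepRgN_subset_WinV G pr φ P w₀ Λ b a' (tgt e) du j pc aw Rlev N M L' _)

omit hΓ hΛ hdu in
/-- The root lies in the support. [folklore] -/
theorem root_mem_faceStepWN_SfinV :
    S.Γ.root ∈ (faceStepWNV G pr φ P w₀ Λ b a' (tgt e) du j pc aw Rlev N M L' (S.Sx G h e a a' du)).Sfin := by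
  show S.Γ.root ∈ S.Sx G h e a a' du
  unfold KSchA.Sx
  exact Finset.mem_union_left _ (Finset.mem_union_left _ hV.root_mem)

omit hΛ hV hdu in
/-- The source of the face step is the scheme's root. [folklore] -/
theorem faceStepWN_root_eqV : (faceStepWNV G pr φ P w₀ Λ b a' (tgt e) du j pc aw Rlev N M L' (S.Sx G h e a a' du)).root = S.Γ.root := by
  rw [hΓ]; rfl

/-- The root lies off the region (from `Lip`, weak steps). [folklore] -/
theorem root_not_mem_faceStepWN_RgV (hlipψ : Lip G (pr.ψ φ w₀)) (hws : WeakSteps G (pr.ψ φ w₀)) :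
    (faceStepWNV G pr φ P w₀ Λ b a' (tgt e) du j pc aw Rlev N M L' (S.Sx G h e a a' du)).root ∉
      stepRg G (pr.frame φ w₀ du.1 b) (faceStepWNV G pr φ P w₀ Λ b a' (tgt e) du j pc aw Rlev N M L' (S.Sx G h e a a' du)) := by
  rw [faceStepWN_root_eqV hΓ]
  exact root_not_mem_sub₂V hΓ hΛ hV hdu hlipψ hws (stepRgN_subset_WinV G pr φ P w₀ Λ b a' (tgt e) du j pc aw Rlev N M L' _)

omit hΓ hΛ hV hdu in
/-- `Wt` is finitely supported on `Sfin = Sx`. [cite: KozmaNitzan2024, §4 p. 28 (Ω)] -/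
theorem finSupp_faceStepWNV :
    KNLevels.FinSupp (S.Wt G h e a a' du j o) (faceStepWNV G pr φ P w₀ Λ b a' (tgt e) du j pc aw Rlev N M L' (S.Sx G h e a a' du)).Sfin :=
  KSchA.finSupp_Wt

omit hΛ hV hdu in
/-- **The planar diameter of `E^far_{a'}(x, du)` under `φ`** from the inverse reading: cell points of `E^far` differ by `≤ 50 rmax` per coordinate
(`EfarN₂ ⊆ FarNS ⊆ cen x ± 25 (r₀, r₁)`), so `φ d − φ d' ∈ [−m, m]²` under the rooms `(rdK 1 b' + rdK 0 b')(50 rmax + 1)D ≤ Mabs(m+1)` (`b' = 0, 1`).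
[folklore] -/
theorem hdiam_fineV (hM : pr.A * TwoAxis.Para.modulus pr.n pr.h pr.vα pr.vβ ≠ 0) (hc₀ : 0 < pr.c₀) (hc₁ : 0 < pr.c₁) (hD : 0 < pr.D) {m : ℕ}
    (hroom : ∀ b' : Fin 2, (pr.rdK 1 b' + pr.rdK 0 b') * ((50 * (P : PCells2V).rmax : ℕ) + 1) * pr.D ≤ pr.Mabs * (m + 1)) (x : Site 2) : ((∀ d ∈ S.Γ.Efar a' x du, ∀ d' ∈ S.Γ.Efar a' x du, φ d - φ d' ∈ box 2 m) : Prop) := by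
  rw [hΓ]
  intro d hd d' hd'
  have hd1 : pr.ψ φ w₀ d ∈ P.FarNS x du := P.FarNS₂_subset_FarNS x du (φ_mem_of_mem_VWin hd)
  have hd2 : pr.ψ φ w₀ d' ∈ P.FarNS x du := P.FarNS₂_subset_FarNS x du (φ_mem_of_mem_VWin hd')
  have hbox := (mem_box.1 (P.sub_mem_box_of_mem_FarNS hd1 hd2))
  have hk : ∀ k, |pr.ψ φ w₀ d k - pr.ψ φ w₀ d' k| ≤ ((50 * P.rmax : ℕ) : ℤ) := fun k => by
    have := hbox k; simp only [Pi.sub_apply] at this; exact abs_le.2 ⟨this.1, this.2⟩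
  exact pr.sub_mem_box_of_read w₀ hc₀ hc₁ hD hM (hk 0) (hk 1) hroom

/-- **The rim excess of the face step**: `P_{Wt}(⋃_{t ∈ T ∖ M_{a'}(x+du)} root ↔ t) ≤ η` from an excess radius `R₁ ≤ rM_{a'}(x+du) − L'` at the
running parameter for the planar map `φ'` (entrance depth `R₀ + 1`, `R₀ ≥ rQ_a(x), sup ρ_{a'}(x, du, ·)`; planar diameter `m` of `E^far` under `φ'`)
(from `Lip`, weak steps of the cell map). [cite: KozmaNitzan2024, §4 Lemma 12 (p. 24)] [cite: MartineauSevero2019, Cor. 2.2] -/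
theorem rim_excess_faceStepWNV [Countable V] (hlipψ : Lip G (pr.ψ φ w₀)) (hws : WeakSteps G (pr.ψ φ w₀)) (hjK : j + 1 ≤ P.K) {R₀ : ℕ}
    (hQ : Λ.rQ a (tgt e) ≤ R₀) (hρ : ∀ ℓ, Λ.ρ a' (tgt e) du ℓ ≤ R₀) {φ' : V → Site 2} {m : ℕ} {η : ℝ} {R₁ : ℕ}
    (hR₁ : ∀ R', R₁ ≤ R' → ∀ (Rw : ℕ) (D' A' : Finset V), (∀ d ∈ D', d ∈ graphBall G w₀ Rw) →
      (∀ d ∈ D', ∀ d' ∈ D', φ' d - φ' d' ∈ box 2 m) → A' ⊆ D' → (∀ a ∈ A', a ∈ graphBall G w₀ (R₀ + 1)) →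
        (bondPercolation G S.p).real (excess G w₀ R' D' A') ≤ η)
    (hR : R₁ ≤ Λ.rM a' (tgt e + stepVec du) - L')
    (hdiam : ∀ d ∈ S.Γ.Efar a' (tgt e) du, ∀ d' ∈ S.Γ.Efar a' (tgt e) du, φ' d - φ' d' ∈ box 2 m) :
    (prodBernoulli (S.Wt G h e a a' du j o)).real
      (⋃ t ∈ (faceStepWNV G pr φ P w₀ Λ b a' (tgt e) du j pc aw Rlev N M L' (S.Sx G h e a a' du)).T \
          S.Γ.M a' (tgt e + stepVec du), openConn S.Γ.root t) ≤ η := by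
  have hroot : S.Γ.root = w₀ := by rw [hΓ]; rfl
  have hsub : (faceStepWNV G pr φ P w₀ Λ b a' (tgt e) du j pc aw Rlev N M L' (S.Sx G h e a a' du)).T \ S.Γ.M a' (tgt e + stepVec du) ⊆
      (stepRg G (pr.frame φ w₀ du.1 b) (faceStepWNV G pr φ P w₀ Λ b a' (tgt e) du j pc aw Rlev N M L' (S.Sx G h e a a' du))).filter
        fun v => v ∉ graphBall G w₀ (Λ.rM a' (tgt e + stepVec du) - L') := by
    rw [hΓ]; exact faceStepWN_T_sdiff_subsetV G pr φ P w₀ Λ b a' (tgt e) du j pc aw Rlev N M L' _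
  rw [hroot]
  refine le_trans (measureReal_mono (Set.iUnion₂_subset fun t ht => ?_) (measure_ne_top _ _))
    (rim_excess_sub₂V hΓ hΛ hV hdu (j := j) (o := o) hlipψ hws hjK hQ hρ hR₁ hR hdiam
      (stepRgN_subset_WinV G pr φ P w₀ Λ b a' (tgt e) du j pc aw Rlev N M L' (S.Sx G h e a a' du)))
  exact Set.subset_biUnion_of_mem (u := fun t => openConn w₀ t) (hsub ht)

end History

end Skelφ

end Summit.CriticalPhenomena.PercolationContinuityZ3.Theorems.Transplant

end

/-!
J23/(R-45) SUCCESSOR `…V` (hp-8 g42, 2026-08-23; ruling lead g12 11:31:15Z, design owner p3-g17 (R-44)/(R-45)): the twin of `SkelPhiFaceDataNbHistT` over the cell structure with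
per-axis ASYMMETRIC transverse rooms `PCells2V` (PlanarCells2VDefs: the slab family `Stub/Zone/Face/Hfull/faceLo/faceHi` has transverse interval `σ·[−hB∥, hF∥]`,
`hB, hF ≤ 2r⊥`, instead of `[−2r⊥, 2r⊥]`; every other box verbatim); statements and proofs VERBATIM with `PCells2T ↦ PCells2V` (+ the renames of record of the
V layer below it); the only mathematical touch points are the places that read the symmetric transverse room (listed in the lane line of this file's landing).
NO landed file is edited; `SkelPhiFaceDataNbHistT` stays valid (it is the instance `PCells2T.toV`, `hB = hF = 2r⊥`). NON-VACUITY: inherited verbatim from `SkelPhiFaceDataNbHistT` (same witness line).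

(R-40) SUCCESSOR `…T` (hp-8 g42, 2026-08-23; ruling p3-g16 06:23:56Z, J18): the twin of `SkelPhiFaceDataNbHistS` over the PER-AXIS creep cap `PCells2V` (PlanarCells2TDefs:
`c i ≤ r (oth i)` instead of the uniform `c i ≤ cmax ≤ r j`); statements and proofs VERBATIM with `PCells2S ↦ PCells2V` (+ the renames of record of the T layer below it);
the only mathematical touch points are the places that read the cap, which only ever need the cross form `c (oth j) ≤ r j` (listed in the lane line of this file's landing).
NO landed file is edited; `SkelPhiFaceDataNbHistS` stays valid (and is an instance of this file through `PCells2S.toT`). NON-VACUITY: inherited verbatim from `SkelPhiFaceDataNbHistS` (same witness line).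

# N2 (frames-only node `SamePDropOfSkeletonFrm₁`, OPEN) — WAVE 1, (F) face-data column over STAGGERED cells ((R-22) `PCells2V`, (R-28)(β) one landing per file): the twin of N1's `SkelPhiFaceDataNbHist`

builds on p205010 (kernel theorem, internal audit signed; external expert review pending) — nothing in this file uses p205010; NOTHING is claimed about the
open node `SamePDropOfSkeletonFrm₁` (`SamePDropOfSkeletonNeg₁` is CLOSED in the tree and untouched by this file).
Status sentence (coordinator 2026-08-20T04:30Z): "θ(p_c) = 0 on ℤ^d, all d ≥ 2 — kernel-verified (Lean 4/Mathlib, standard axioms); internal adversarial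
audit SIGNED 2026-08-20 04:29Z; external expert review pending."
Lane `prim-bschramm`, seat `prim-hp-8` (gen 40); helper file (`--supports stmt-CriticalPhenomena-4575 --as helper`); design owner p3-g15 ((R-22) staggered
cells `PCells2V`, (R-27)/(R-29) far regions of record `FarNS/FarNS₂`, (R-28)(β), naming 2026-08-22T23:00:04Z: suffix `S`).
PORT RULES (HOME/prim-hp-8/code/gen40/orient/bin/port_s.py = stmt-g19's port_orient.py + the G token table): the cells are `P : PCells2V`, every box is
read about the STAGGERED centre `cenS` (`PlanarCells2SDefs/SFar/ContainS/SArm/SepS/SepInfS/LevelsS/EfarN2S`), the scheme record is `cellGeomSG₂V`/`cellGeomSG₂bV`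
(`SkelPhiCellsWeakGS/…SmallMS`: narrow arm `BtwNS`, two-block far region `FarNS₂`), the history-site API is the ORIENTED one at `qNE` where it occurs
(`ochoice qNE`, `onwardO`, `Valid₂O`, `IsRun₂O`, …, (R-18)); EVERY declaration is re-declared with the suffix `S` (same namespace). Docstrings/citations are N1's.
N1 HEADER (kept for the reader):
* `isSubbox_faceStepWNb`, `faceStepWNb_Rg_subset_Sfin`, `root_mem_faceStepWNb_Sfin`, `faceStepWNb_root_eq`, `root_not_mem_faceStepWNb_Rg`,
  `finSupp_faceStepWNb`, `hdiam_fine_b`, **`rim_excess_faceStepWNb`**.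
[cite: KozmaNitzan2024, §4 p. 27 ((30)), p. 28 (Ω), p. 31, Lemma 12 (p. 24)] [cite: MartineauSevero2019, Cor. 2.2]
-/
noncomputable section

open MeasureTheory
open scoped Classical

namespace Summit.CriticalPhenomena.PercolationContinuityZ3.Theorems.Transplant

namespace Skelφ

open Literature.Probability.Percolation Literature.Probability.LatticeModels SimpleGraph KNCells KNLevels GadgetSystem Contour
open Literature.Probability.Percolation.KozmaNitzan
open Literature.Probability.Percolation.KozmaNitzan.Cells (oth oth_ne sgOf sgOf_sign stepVec_apply_fst stepVec_apply_oth eq_oth_of_ne oth_oth)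
open Literature.Barriers.CriticalPhenomena (graphBall graphBall_finite mem_graphBall_self graphBall_mono)
open BoxProdZ2 (ConcRadiiG mem_graphBall_succ_of_adj)
open Skel (winGraph WinStepData excess)

variable {V : Type} [DecidableEq V] {G : SimpleGraph V} [G.LocallyFinite]
variable {pr : FinePrm} {φ : V → Site 2} {P : PCells2V} {w₀ : V} {Λ : ConcRadiiG} {b₀ : Fin 2 → ℕ} {b : Fin 2}

/-! ## §3b The clauses that need the history, small target -/

section History

variable {p : unitInterval} {δc : ℝ} (hΛ : WFS2 P.toPCells2 Λ) (hb₀ : ∀ i, b₀ i ≤ 3 * P.r i)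
variable {h : ProbeHistory V} {e : Site 2 × MDir} (hV : (⟨cellGeomSG₂bV G (pr.ψ φ w₀) P w₀ Λ b₀, p, δc⟩ : KSchA V ℕ).Valid₂O G h e) {a a' : ℕ} {du : MDir} (hdu : du ∈ (⟨cellGeomSG₂bV G (pr.ψ φ w₀) P w₀ Λ b₀, p, δc⟩ : KSchA V ℕ).onwardO G h (tgt e))
variable {j : ℕ} {o : Finset (Sym2 V)} (pc : ℤ) (aw Rlev N M L' : ℕ)

include hΛ hb₀ hV hdu

/-- **The region of the face step is a subbox of `Wt` in its window graph** (from `Lip`, weak steps of the cell map). [cite: KozmaNitzan2024, §4 p. 31] -/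
theorem isSubbox_faceStepWNbV (hlipψ : Lip G (pr.ψ φ w₀)) (hws : WeakSteps G (pr.ψ φ w₀)) (hjK : j + 1 ≤ P.K) :
    let Q := faceStepWNbV G pr φ P w₀ Λ b₀ b a' (tgt e) du j pc aw Rlev N M L' ((⟨cellGeomSG₂bV G (pr.ψ φ w₀) P w₀ Λ b₀, p, δc⟩ : KSchA V ℕ).Sx G h e a a' du)
    KNLevels.IsSubbox (winGraph G Q.root Q.Rπ) ((⟨cellGeomSG₂bV G (pr.ψ φ w₀) P w₀ Λ b₀, p, δc⟩ : KSchA V ℕ).Wt G h e a a' du j o) (⟨cellGeomSG₂bV G (pr.ψ φ w₀) P w₀ Λ b₀, p, δc⟩ : KSchA V ℕ).p (stepRg G (pr.frame φ w₀ du.1 b) Q) := by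
  exact isSubbox_Wt_sub₂bV hΛ hb₀ hV hdu hlipψ hws hjK (stepRgNb_subset_WinV G pr φ P w₀ Λ b₀ b a' (tgt e) du j pc aw Rlev N M L' _)

omit hV hdu hb₀ in
/-- `Rg ⊆ Sfin = Sx` (from `Lip`, weak steps). [folklore] -/
theorem faceStepWNb_Rg_subset_SfinV (hlipψ : Lip G (pr.ψ φ w₀)) (hws : WeakSteps G (pr.ψ φ w₀)) :
    let Q := faceStepWNbV G pr φ P w₀ Λ b₀ b a' (tgt e) du j pc aw Rlev N M L' ((⟨cellGeomSG₂bV G (pr.ψ φ w₀) P w₀ Λ b₀, p, δc⟩ : KSchA V ℕ).Sx G h e a a' du)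
    stepRg G (pr.frame φ w₀ du.1 b) Q ⊆ Q.Sfin := by
  exact sub_subset_Sx₂bV hΛ hlipψ hws (stepRgNb_subset_WinV G pr φ P w₀ Λ b₀ b a' (tgt e) du j pc aw Rlev N M L' _)

omit hΛ hdu hb₀ in
/-- The root lies in the support. [folklore] -/
theorem root_mem_faceStepWNb_SfinV :
    (⟨cellGeomSG₂bV G (pr.ψ φ w₀) P w₀ Λ b₀, p, δc⟩ : KSchA V ℕ).Γ.root ∈ (faceStepWNbV G pr φ P w₀ Λ b₀ b a' (tgt e) du j pc aw Rlev N M L' ((⟨cellGeomSG₂bV G (pr.ψ φ w₀) P w₀ Λ b₀, p, δc⟩ : KSchA V ℕ).Sx G h e a a' du)).Sfin := by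
  show (⟨cellGeomSG₂bV G (pr.ψ φ w₀) P w₀ Λ b₀, p, δc⟩ : KSchA V ℕ).Γ.root ∈ (⟨cellGeomSG₂bV G (pr.ψ φ w₀) P w₀ Λ b₀, p, δc⟩ : KSchA V ℕ).Sx G h e a a' du
  unfold KSchA.Sx
  exact Finset.mem_union_left _ (Finset.mem_union_left _ hV.root_mem)

omit hΛ hV hdu hb₀ in
/-- The source of the face step is the scheme's root. [folklore] -/
theorem faceStepWNb_root_eqV : (faceStepWNbV G pr φ P w₀ Λ b₀ b a' (tgt e) du j pc aw Rlev N M L' ((⟨cellGeomSG₂bV G (pr.ψ φ w₀) P w₀ Λ b₀, p, δc⟩ : KSchA V ℕ).Sx G h e a a' du)).root = (⟨cellGeomSG₂bV G (pr.ψ φ w₀) P w₀ Λ b₀, p, δc⟩ : KSchA V ℕ).Γ.root :=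
  rfl

/-- The root lies off the region (from `Lip`, weak steps). [folklore] -/
theorem root_not_mem_faceStepWNb_RgV (hlipψ : Lip G (pr.ψ φ w₀)) (hws : WeakSteps G (pr.ψ φ w₀)) :
    (faceStepWNbV G pr φ P w₀ Λ b₀ b a' (tgt e) du j pc aw Rlev N M L' ((⟨cellGeomSG₂bV G (pr.ψ φ w₀) P w₀ Λ b₀, p, δc⟩ : KSchA V ℕ).Sx G h e a a' du)).root ∉
      stepRg G (pr.frame φ w₀ du.1 b) (faceStepWNbV G pr φ P w₀ Λ b₀ b a' (tgt e) du j pc aw Rlev N M L' ((⟨cellGeomSG₂bV G (pr.ψ φ w₀) P w₀ Λ b₀, p, δc⟩ : KSchA V ℕ).Sx G h e a a' du)) := by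
  exact root_not_mem_sub₂bV hΛ hb₀ hV hdu hlipψ hws (stepRgNb_subset_WinV G pr φ P w₀ Λ b₀ b a' (tgt e) du j pc aw Rlev N M L' _)

omit hΛ hV hdu hb₀ in
/-- `Wt` is finitely supported on `Sfin = Sx`. [cite: KozmaNitzan2024, §4 p. 28 (Ω)] -/
theorem finSupp_faceStepWNbV :
    KNLevels.FinSupp ((⟨cellGeomSG₂bV G (pr.ψ φ w₀) P w₀ Λ b₀, p, δc⟩ : KSchA V ℕ).Wt G h e a a' du j o) (faceStepWNbV G pr φ P w₀ Λ b₀ b a' (tgt e) du j pc aw Rlev N M L' ((⟨cellGeomSG₂bV G (pr.ψ φ w₀) P w₀ Λ b₀, p, δc⟩ : KSchA V ℕ).Sx G h e a a' du)).Sfin :=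
  KSchA.finSupp_Wt

omit hΛ hV hdu hb₀ in
/-- **The planar diameter of `E^far_{a'}(x, du)` under `φ`** (the twin's `E^far` is the old one): from the inverse reading, under the rooms
`(rdK 1 b' + rdK 0 b')(50 rmax + 1)D ≤ Mabs(m+1)`. [folklore] -/
theorem hdiam_fine_bV (hM : pr.A * TwoAxis.Para.modulus pr.n pr.h pr.vα pr.vβ ≠ 0) (hc₀ : 0 < pr.c₀) (hc₁ : 0 < pr.c₁) (hD : 0 < pr.D) {m : ℕ}
    (hroom : ∀ b' : Fin 2, (pr.rdK 1 b' + pr.rdK 0 b') * ((50 * P.rmax : ℕ) + 1) * pr.D ≤ pr.Mabs * (m + 1)) (x : Site 2) (δ : MDir) :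
    ∀ d ∈ (cellGeomSG₂bV G (pr.ψ φ w₀) P w₀ Λ b₀).Efar a' x δ, ∀ d' ∈ (cellGeomSG₂bV G (pr.ψ φ w₀) P w₀ Λ b₀).Efar a' x δ,
      φ d - φ d' ∈ box 2 m := by
  intro d hd d' hd'
  have hd1 : pr.ψ φ w₀ d ∈ P.FarNS x δ := P.FarNS₂_subset_FarNS x δ (φ_mem_of_mem_VWin hd)
  have hd2 : pr.ψ φ w₀ d' ∈ P.FarNS x δ := P.FarNS₂_subset_FarNS x δ (φ_mem_of_mem_VWin hd')
  have hbox := (mem_box.1 (P.sub_mem_box_of_mem_FarNS hd1 hd2))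
  have hk : ∀ k, |pr.ψ φ w₀ d k - pr.ψ φ w₀ d' k| ≤ ((50 * P.rmax : ℕ) : ℤ) := fun k => by
    have := hbox k; simp only [Pi.sub_apply] at this; exact abs_le.2 ⟨this.1, this.2⟩
  exact pr.sub_mem_box_of_read w₀ hc₀ hc₁ hD hM (hk 0) (hk 1) hroom

/-- **The rim excess of the face step** (small target): `P_{Wt}(⋃_{t ∈ T ∖ M_{a'}(x+du)} root ↔ t) ≤ η` from an excess radius `R₁ ≤ rM − L'` at the
running parameter for the planar map `φ'` (entrance depth `R₀ + 1`; planar diameter `m` of `E^far` under `φ'`).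
[cite: KozmaNitzan2024, §4 Lemma 12 (p. 24)] [cite: MartineauSevero2019, Cor. 2.2] -/
theorem rim_excess_faceStepWNbV [Countable V] (hlipψ : Lip G (pr.ψ φ w₀)) (hws : WeakSteps G (pr.ψ φ w₀)) (hjK : j + 1 ≤ P.K) {R₀ : ℕ}
    (hQ : Λ.rQ a (tgt e) ≤ R₀) (hρ : ∀ ℓ, Λ.ρ a' (tgt e) du ℓ ≤ R₀) {φ' : V → Site 2} {m : ℕ} {η : ℝ} {R₁ : ℕ}
    (hR₁ : ∀ R', R₁ ≤ R' → ∀ (Rw : ℕ) (D' A' : Finset V), (∀ d ∈ D', d ∈ graphBall G w₀ Rw) →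
      (∀ d ∈ D', ∀ d' ∈ D', φ' d - φ' d' ∈ box 2 m) → A' ⊆ D' → (∀ a ∈ A', a ∈ graphBall G w₀ (R₀ + 1)) →
        (bondPercolation G (⟨cellGeomSG₂bV G (pr.ψ φ w₀) P w₀ Λ b₀, p, δc⟩ : KSchA V ℕ).p).real (excess G w₀ R' D' A') ≤ η)
    (hR : R₁ ≤ Λ.rM a' (tgt e + stepVec du) - L')
    (hdiam : ∀ d ∈ (⟨cellGeomSG₂bV G (pr.ψ φ w₀) P w₀ Λ b₀, p, δc⟩ : KSchA V ℕ).Γ.Efar a' (tgt e) du, ∀ d' ∈ (⟨cellGeomSG₂bV G (pr.ψ φ w₀) P w₀ Λ b₀, p, δc⟩ : KSchA V ℕ).Γ.Efar a' (tgt e) du, φ' d - φ' d' ∈ box 2 m) :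
    (prodBernoulli ((⟨cellGeomSG₂bV G (pr.ψ φ w₀) P w₀ Λ b₀, p, δc⟩ : KSchA V ℕ).Wt G h e a a' du j o)).real
      (⋃ t ∈ (faceStepWNbV G pr φ P w₀ Λ b₀ b a' (tgt e) du j pc aw Rlev N M L' ((⟨cellGeomSG₂bV G (pr.ψ φ w₀) P w₀ Λ b₀, p, δc⟩ : KSchA V ℕ).Sx G h e a a' du)).T \
          (⟨cellGeomSG₂bV G (pr.ψ φ w₀) P w₀ Λ b₀, p, δc⟩ : KSchA V ℕ).Γ.M a' (tgt e + stepVec du), openConn (⟨cellGeomSG₂bV G (pr.ψ φ w₀) P w₀ Λ b₀, p, δc⟩ : KSchA V ℕ).Γ.root t) ≤ η := by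
  have hroot : (⟨cellGeomSG₂bV G (pr.ψ φ w₀) P w₀ Λ b₀, p, δc⟩ : KSchA V ℕ).Γ.root = w₀ := rfl
  have hsub : (faceStepWNbV G pr φ P w₀ Λ b₀ b a' (tgt e) du j pc aw Rlev N M L' ((⟨cellGeomSG₂bV G (pr.ψ φ w₀) P w₀ Λ b₀, p, δc⟩ : KSchA V ℕ).Sx G h e a a' du)).T \ (⟨cellGeomSG₂bV G (pr.ψ φ w₀) P w₀ Λ b₀, p, δc⟩ : KSchA V ℕ).Γ.M a' (tgt e + stepVec du) ⊆
      (stepRg G (pr.frame φ w₀ du.1 b) (faceStepWNbV G pr φ P w₀ Λ b₀ b a' (tgt e) du j pc aw Rlev N M L' ((⟨cellGeomSG₂bV G (pr.ψ φ w₀) P w₀ Λ b₀, p, δc⟩ : KSchA V ℕ).Sx G h e a a' du))).filter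
        fun v => v ∉ graphBall G w₀ (Λ.rM a' (tgt e + stepVec du) - L') := by
    exact faceStepWNb_T_sdiff_subsetV G pr φ P w₀ Λ b₀ b a' (tgt e) du j pc aw Rlev N M L' _
  rw [hroot]
  refine le_trans (measureReal_mono (Set.iUnion₂_subset fun t ht => ?_) (measure_ne_top _ _))
    (rim_excess_sub₂bV hΛ hb₀ hV hdu (j := j) (o := o) hlipψ hws hjK hQ hρ hR₁ hR hdiam
      (stepRgNb_subset_WinV G pr φ P w₀ Λ b₀ b a' (tgt e) du j pc aw Rlev N M L' ((⟨cellGeomSG₂bV G (pr.ψ φ w₀) P w₀ Λ b₀, p, δc⟩ : KSchA V ℕ).Sx G h e a a' du)))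
  exact Set.subset_biUnion_of_mem (u := fun t => openConn w₀ t) (hsub ht)

end History

end Skelφ

end Summit.CriticalPhenomena.PercolationContinuityZ3.Theorems.Transplant

end
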